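import Literature.MathematicalPhysics.QuantumFieldTheory.Balaban1983to89.B16RLeafRecord13SepCoPH

/-!
# `Balaban1983to89.B16RLeafRecord13SepCoPHSelLaws` — YM-DAG node N13's (R₁₃) row AT node00-def-T's RECORD 13 v1.7 `CoPH` SEPARATED RECORD (`Node00/Record13SepCoPH.lean`),
# KEYED ON THE SELECTOR LAWS of [Balaban1989LargeFieldI] p. 177 (i)–(ii) — (i) the level-`k+1` selector is IDEMPOTENT, (ii) it MOVES ONLY DEAD SEQUENCES (zero fibre mass of
# the 𝐓-term everywhere) — in place of the selector EQUATION `hsel : θ.ppSel = ppSelLiveOfRecord …` of `…B16RLeafRecord13SepCoPH`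
# ([Balaban1988Convergent] p. 244, (2.17)–(2.18) p. 257, Thm 1 p. 262, Thm 2 p. 263, (3.24)–(3.25) p. 270; [Balaban1989LargeFieldI] (0.2)–(0.4) p. 176, (i)–(ii) p. 177;
# [Balaban1989LargeFieldII] Thm 1 p. 355)

statement-level bookkeeping over published theorems with citation tags; kernel-checked compositions of tree theorems;
nothing here is a claim about the Yang–Mills mass gap.

Cell `pub-ymgap` (HUMAN RULING D-0062 Track A; D-0149 width seat `pub-ymgap-dag-n13-w1`, g0), plan g77 W-SEAT-START-LIST §n13 ITEM 1 «`hR` at the record WITHOUT the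
live-selector side conditions».  [III] = [Balaban1988Convergent], [IV] = [Balaban1989LargeFieldI], [B16] = [Balaban1989LargeFieldII].

WHY THIS FILE.  The v1.7 storeys `…B16RLeafRecord13LiveCoPH` ∕ `…B16RLeafRecord13SepCoPH` (seat dag-n11-e) carry N13's (R₁₃CoPH) row `∀ k < K, TLaw₁₃CoPH θ p k →
SLaw₁₃CoPH θ p (k+1)`, the 𝐑-leaf `ROpLeaf (VOfRecord₁₃CoPH θ p)`, the run's `rOperation`, «𝐑 of record = identity a.e.», Theorem 1's induction and the (B)-face conjunct
`B16.Thm1Printed (datumOfRecord₁₃SepCoPH θ h).C` ONLY at the selector EQUATION `hsel` (the `_of_liveSel_` faces) and its instances (K0a's re-pin, the witnesses).  The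
v1.2-record storeys (`…B16RLeafRecord13Live` §2–§5, `…B16RLeafRecord13LiveRstep` §1) had the same faces keyed on the two selector LAWS `hidem ∕ hdead` — the shape in which
[IV] p. 177 STATES what 𝐑 does («(i) … (ii) …»: a projection onto the sequences that are kept, the moved ones carrying no fibre mass) — and the history-indexed LAW-LEVEL
engine for them IS in the tree (`…B16RLeafRecord13LiveGenericZS` §1: `hasSect2FormAEZS_succ_of_TAEZS_of_idem_of_dead_of_rstep`, `…_of_liveTAEZS_…`,
`slotsT_succ_aeForm_of_AEZS_succ_of_dead_of_rstep`, `aeClause_of_Omega_empty_of_AEZS_succ_of_dead_of_rstep`; `…LiveRstep.densOfRecord₁₃_succ_ae_eq_tdens_of_idem_of_dead_of_rstep`),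
but no v1.7 `CoPH`-law ∕ leaf ∕ world ∕ datum face keyed on the laws was ported.  THIS FILE is that port, from `h : θ.Provisos₁₃SepCoPH F N` (row `rstep` only, via
`Provisos₁₃SepCoPH.toCore` ∕ `rstep_of_provisos₁₃SepCoPH`) + admissibility + the three term-constant signs + the selector laws of the run:
§0  at the CORE provisos `Provisos₁₃CoPH` (FILE 27; the key dag-n12-d's S-bound four-pin engine `nodes₁₃CoPH_upS_fourPinW₀_pointed` reads): one level
    `sLaw₁₃CoPH_succ_of_tLaw₁₃CoPH_of_selLaws_coPH`, the leaf `rOpLeaf_VOfRecord₁₃CoPH_of_selLaws_coPH`, ★ the engine's row `laws₁₃CoPH_of_selLaws_coPH`.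
§1  per run `p` at `Provisos₁₃SepCoPH`: `sLaw₁₃CoPH_succ_of_tLaw₁₃CoPH_of_selLaws_sepCoPH` (one level), ★ `laws₁₃CoPH_of_selLaws_sepCoPH` (THE ROW `hR`), `rOpLeaf_VOfRecord₁₃CoPH_of_selLaws_sepCoPH`,
    `rOperation_leavesP_of_selLaws₁₃CoPH_sepCoPH` (world bound to `upOfRecord₅C … (θ.toStage5₁₃CoPH)`), `densOfRecord₁₃_succ_ae_eq_tdens_of_selLaws_sepCoPH` (`ρ_{k+1} = 𝐓ρ_k` a.e.;
    NO admissibility ∕ sign), the converse `slotsT_succ_aeForm_of_sLaw₁₃CoPH_succ_of_deadSel_sepCoPH` and the guard-free clause `sLaw₁₃CoPH_succ_clause_of_Omega_empty_of_deadSel_sepCoPH`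
    (law (ii) ONLY), the `LiveSeq`-guarded step `sLaw₁₃CoPH_succ_of_tLawLiveSeq_of_selLaws_sepCoPH` (K0a's currency), Theorem 1's induction from the full (S1ᵀ)
    `sLaw₁₃CoPH_all_of_thmP245_of_selLaws_sepCoPH`.
§2  at the datum `datumOfRecord₁₃SepCoPH F N θ h`: `densitiesDescribed_at_record₁₃SepCoPH_of_selLaws`, the N11 node `b14_main_at_record₁₃SepCoPH_of_selLaws` (one displayed slot (S1ᵀ)),
    ★ the (B)-face's first conjunct `thm1Printed_datumOfRecord₁₃SepCoPH_of_laws_of_selLaws` (full (S1ᵀ)) ∕ `…_of_lawsLive_of_selLaws` ((S1ᵀ) at the `LiveSeq` sequences of the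
    windowed runs only; selector laws demanded on the windowed runs only).
§3  INSTANCES (non-vacuity of the selector-law hypotheses relative to the existing currency, A6): the IDENTITY selector obeys (i) trivially and (ii) vacuously
    (`laws₁₃CoPH_of_forall_sel_eq_sepCoPH`, `densOfRecord₁₃_succ_ae_eq_tdens_of_forall_sel_eq_sepCoPH`: a selector fixing every level-`k+1` sequence — the Stage-13 `CoPH` twin of
    n13-c's `…B16RLeafRecord11.rOpLeaf_VOfRecord₁₁_of_forall_sel_eq`); node00-def-T's LIVE selector obeys (i)(ii) by `…B16RLeafRecord13Live.ppSel_succ_idem_of_liveSel` ∕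
    `dead_of_ppSel_succ_ne_of_liveSel`, so n11-e's `…SepCoPH.laws₁₃CoPH_of_liveSel_sepCoPH` IS the instance `hidem := fun k _ => ppSel_succ_idem_of_liveSel … hsel p k`,
    `hdead := fun k _ a hne V => dead_of_ppSel_succ_ne_of_liveSel … hsel p k a hne V` of §1's row (not restated here: it is landed).

HONEST SCOPE: count-neutral composition BY NAME of dag-n11-e's engines with node00-def-T's `Iff`s; on ANY law-abiding selector 𝐑 of record integrates out only terms of zero fibre mass
([IV] p. 177 (i)–(ii)) — [B16] Theorem 1's 𝐑-construction is NOT exercised; the hypotheses (`Provisos₁₃SepCoPH` = the rev-24 K0⁷-class item, admissibility, `0 ≤ κ, E₀, B₀`, the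
selector laws, (S1ᵀ) = N11's analysis) are DISPLAYED, never asserted, and are jointly satisfiable exactly when K0⁷ is (the live selector obeys the laws by theorem, §3); nothing
of Bałaban is asserted; N13 NOT discharged; N11 NOT discharged; one finite `𝕋⁴_{L^K}` programme at fixed `ε = L^{−K}` — NOT a continuum ∕ ℝ⁴ ∕ OS ∕ mass-gap ∕ Clay statement.
No `def`, no `sorry`, no `instance`, no `notation`.
-/

noncomputable section

open MeasureTheory
open scoped BigOperators Matrix.Norms.L2Operator

namespace Literature.MathematicalPhysics.QuantumFieldTheory.Balaban1983to89.B16RLeafRecord13SepCoPHSelLaws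

open T4Continuum T4DatumAssembly Node00 B14.Eq218Concrete DagBinding
open B16RLeafRecord11 B16RLeafRecord12 B16RLeafRecord12Live B16RLeafRecord12AtLive
open B16RLeafRecord13Live B16RLeafRecord13AtLive B16RLeafRecord13LiveRstep B16RLeafRecord13LiveGenericZS B16RLeafRecord13LiveCoPH B16RLeafRecord13SepCoPH

variable (F : T4Family) (N : ℕ) [NeZero N]

/-! ## §0  AT THE CORE PROVISOS `h : θ.Provisos₁₃CoPH F N` (node00-def-T FILE 27; the key of dag-n12-d's S-bound four-pin ENGINE `nodes₁₃CoPH_upS_fourPinW₀_pointed`, whose row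
## `hR` this section supplies on every law-abiding selector): one level, the 𝐑-leaf, the row -/

section Core

variable (θ : Stage13HParams F N) (p : B12.RunParams)

/-- **ONE LEVEL AT THE CORE: `TLaw₁₃CoPH θ p k → SLaw₁₃CoPH θ p (k+1)` from `Provisos₁₃CoPH`'s row `rstep`, admissibility, the three term-constant signs and the two SELECTOR LAWS AT
LEVEL `k+1`** — (i) `hidem`: the selector is idempotent; (ii) `hdead`: a moved sequence is dead (its 𝐓-term has zero fibre mass at every `V`).  (G6″)'s forward step
`hasSect2FormAEZS_succ_of_TAEZS_of_idem_of_dead_of_rstep` at `(Rz, W, U) := (θ.rzAt p, WtOfRecord₁₃H θ p, UbgOfRecord₁₃CoP θ.toStage13Params p (k+1))` through node00-def-T's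
`sLaw₁₃CoPH_iff ∕ tLaw₁₃CoPH_iff`. [cite: Balaban1988Convergent, §2 p.262, Thm 2 p.263, (3.24)–(3.25) p.270; Balaban1989LargeFieldI, (0.3) p.176, p.177 (i)–(ii)] -/
theorem sLaw₁₃CoPH_succ_of_tLaw₁₃CoPH_of_selLaws_coPH (h : θ.Provisos₁₃CoPH F N) (hθ : θ.Admissible F N) (hκ : 0 ≤ θ.s2.lf.κ) (hE₀ : 0 ≤ θ.s2.lf.E₀)
    (hB₀ : 0 ≤ θ.s2.lf.B₀) (k : ℕ) (hk : k < p.K)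
    (hidem : ∀ a, θ.ppSel p (gOfRecord₁₃ F N θ.toStage13Params p) (k + 1) (θ.ppSel p (gOfRecord₁₃ F N θ.toStage13Params p) (k + 1) a)
      = θ.ppSel p (gOfRecord₁₃ F N θ.toStage13Params p) (k + 1) a)
    (hdead : ∀ a, θ.ppSel p (gOfRecord₁₃ F N θ.toStage13Params p) (k + 1) a ≠ a →
      ∀ V, B15.BasicStep.fibreIntegral (fibOfSeq F θ.ν θ.τ9 p (gOfRecord₁₃ F N θ.toStage13Params p) (k + 1) a)
        (rterm (sliceOfRecord F N θ.ν θ.τ9.M p (gOfRecord₁₃ F N θ.toStage13Params p) (k + 1)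
          (slotsTOfRecord F N θ.ν θ.τ9 (EOfRecord₁₃ F N θ.toStage13Params) (wOfRecord₉ F N θ.toStage9Params) θ.ppSel p (gOfRecord₁₃ F N θ.toStage13Params p) (k + 1))) a) V = 0)
    (hT : TLaw₁₃CoPH F N θ p k) : SLaw₁₃CoPH F N θ p (k + 1) :=
  (sLaw₁₃CoPH_iff F N θ p (k + 1)).mpr
    (hasSect2FormAEZS_succ_of_TAEZS_of_idem_of_dead_of_rstep F N θ.toStage13Params p (fun p k _ hk => h.rstep p k hk) hθ hκ hE₀ hB₀ k hk hidem hdead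
      (θ.rzAt p) (WtOfRecord₁₃H F N θ p) (UbgOfRecord₁₃CoP F N θ.toStage13Params p (k + 1)) ((tLaw₁₃CoPH_iff F N θ p k).mp hT))

/-- **★ THE 𝐑-LEAF OF RECORD AT v1.7 `CoPH`, `ROpLeaf (VOfRecord₁₃CoPH θ p)`, AT THE CORE PROVISOS ON A LAW-ABIDING SELECTOR** (laws (i)(ii) at every level `k+1 ≤ K`; admissibility, signs).
[cite: Balaban1988Convergent, p.244, Thm 2 p.263; Balaban1989LargeFieldI, (0.3) p.176, p.177 (i)–(ii); Balaban1989LargeFieldII, Thm 1 p.355 (not exercised)] -/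
theorem rOpLeaf_VOfRecord₁₃CoPH_of_selLaws_coPH (h : θ.Provisos₁₃CoPH F N) (hθ : θ.Admissible F N) (hκ : 0 ≤ θ.s2.lf.κ) (hE₀ : 0 ≤ θ.s2.lf.E₀)
    (hB₀ : 0 ≤ θ.s2.lf.B₀)
    (hidem : ∀ k, k < p.K → ∀ a, θ.ppSel p (gOfRecord₁₃ F N θ.toStage13Params p) (k + 1) (θ.ppSel p (gOfRecord₁₃ F N θ.toStage13Params p) (k + 1) a)
      = θ.ppSel p (gOfRecord₁₃ F N θ.toStage13Params p) (k + 1) a)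
    (hdead : ∀ k, k < p.K → ∀ a, θ.ppSel p (gOfRecord₁₃ F N θ.toStage13Params p) (k + 1) a ≠ a →
      ∀ V, B15.BasicStep.fibreIntegral (fibOfSeq F θ.ν θ.τ9 p (gOfRecord₁₃ F N θ.toStage13Params p) (k + 1) a)
        (rterm (sliceOfRecord F N θ.ν θ.τ9.M p (gOfRecord₁₃ F N θ.toStage13Params p) (k + 1)
          (slotsTOfRecord F N θ.ν θ.τ9 (EOfRecord₁₃ F N θ.toStage13Params) (wOfRecord₉ F N θ.toStage9Params) θ.ppSel p (gOfRecord₁₃ F N θ.toStage13Params p) (k + 1))) a) V = 0) :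
    ROpLeaf (VOfRecord₁₃CoPH F N θ p) :=
  (rOpLeaf_VOfRecord₁₃CoPH_iff F N θ p).mpr fun k hk hT =>
    sLaw₁₃CoPH_succ_of_tLaw₁₃CoPH_of_selLaws_coPH F N θ p h hθ hκ hE₀ hB₀ k hk (hidem k hk) (hdead k hk) hT

/-- **★ N13's (R₁₃CoPH) ROW `hR` OF THE ENGINE — `∀ k < K, TLaw₁₃CoPH θ p k → SLaw₁₃CoPH θ p (k+1)` — AT THE CORE PROVISOS ON A LAW-ABIDING SELECTOR** (the hypothesis `hR` of
`…N12AtRecord13SepCoPHSockets.nodes₁₃CoPH_upS_fourPinW₀_pointed`, run by run). [cite: Balaban1988Convergent, p.244 (bookkeeping); Balaban1989LargeFieldI, p.177 (i)–(ii); Balaban1989LargeFieldII, Thm 1 p.355 (not exercised)] -/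
theorem laws₁₃CoPH_of_selLaws_coPH (h : θ.Provisos₁₃CoPH F N) (hθ : θ.Admissible F N) (hκ : 0 ≤ θ.s2.lf.κ) (hE₀ : 0 ≤ θ.s2.lf.E₀) (hB₀ : 0 ≤ θ.s2.lf.B₀)
    (hidem : ∀ k, k < p.K → ∀ a, θ.ppSel p (gOfRecord₁₃ F N θ.toStage13Params p) (k + 1) (θ.ppSel p (gOfRecord₁₃ F N θ.toStage13Params p) (k + 1) a)
      = θ.ppSel p (gOfRecord₁₃ F N θ.toStage13Params p) (k + 1) a)
    (hdead : ∀ k, k < p.K → ∀ a, θ.ppSel p (gOfRecord₁₃ F N θ.toStage13Params p) (k + 1) a ≠ a →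
      ∀ V, B15.BasicStep.fibreIntegral (fibOfSeq F θ.ν θ.τ9 p (gOfRecord₁₃ F N θ.toStage13Params p) (k + 1) a)
        (rterm (sliceOfRecord F N θ.ν θ.τ9.M p (gOfRecord₁₃ F N θ.toStage13Params p) (k + 1)
          (slotsTOfRecord F N θ.ν θ.τ9 (EOfRecord₁₃ F N θ.toStage13Params) (wOfRecord₉ F N θ.toStage9Params) θ.ppSel p (gOfRecord₁₃ F N θ.toStage13Params p) (k + 1))) a) V = 0) :
    ∀ k, k < p.K → TLaw₁₃CoPH F N θ p k → SLaw₁₃CoPH F N θ p (k + 1) :=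
  fun k hk hT => sLaw₁₃CoPH_succ_of_tLaw₁₃CoPH_of_selLaws_coPH F N θ p h hθ hκ hE₀ hB₀ k hk (hidem k hk) (hdead k hk) hT

end Core

/-! ## §1  The (R₁₃CoPH) row of the run `p` from `h : θ.Provisos₁₃SepCoPH F N` and the SELECTOR LAWS of [IV] p. 177 (i)–(ii) -/

section SelLaws

variable (θ : Stage13HParams F N) (p : B12.RunParams)

/-- **ONE LEVEL: `TLaw₁₃CoPH θ p k → SLaw₁₃CoPH θ p (k+1)` from `Provisos₁₃SepCoPH`'s row `rstep`, admissibility, the three term-constant signs and the two SELECTOR LAWS AT LEVEL `k+1`**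
(§0 at `h.toCore`: `Provisos₁₃SepCoPH` carries the row `rstep` verbatim). [cite: Balaban1988Convergent, §2 p.262, Thm 2 p.263, (3.24)–(3.25) p.270; Balaban1989LargeFieldI, (0.3) p.176, p.177 (i)–(ii)] -/
theorem sLaw₁₃CoPH_succ_of_tLaw₁₃CoPH_of_selLaws_sepCoPH (h : θ.Provisos₁₃SepCoPH F N) (hθ : θ.Admissible F N) (hκ : 0 ≤ θ.s2.lf.κ) (hE₀ : 0 ≤ θ.s2.lf.E₀)
    (hB₀ : 0 ≤ θ.s2.lf.B₀) (k : ℕ) (hk : k < p.K)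
    (hidem : ∀ a, θ.ppSel p (gOfRecord₁₃ F N θ.toStage13Params p) (k + 1) (θ.ppSel p (gOfRecord₁₃ F N θ.toStage13Params p) (k + 1) a)
      = θ.ppSel p (gOfRecord₁₃ F N θ.toStage13Params p) (k + 1) a)
    (hdead : ∀ a, θ.ppSel p (gOfRecord₁₃ F N θ.toStage13Params p) (k + 1) a ≠ a →
      ∀ V, B15.BasicStep.fibreIntegral (fibOfSeq F θ.ν θ.τ9 p (gOfRecord₁₃ F N θ.toStage13Params p) (k + 1) a)
        (rterm (sliceOfRecord F N θ.ν θ.τ9.M p (gOfRecord₁₃ F N θ.toStage13Params p) (k + 1)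
          (slotsTOfRecord F N θ.ν θ.τ9 (EOfRecord₁₃ F N θ.toStage13Params) (wOfRecord₉ F N θ.toStage9Params) θ.ppSel p (gOfRecord₁₃ F N θ.toStage13Params p) (k + 1))) a) V = 0)
    (hT : TLaw₁₃CoPH F N θ p k) : SLaw₁₃CoPH F N θ p (k + 1) :=
  sLaw₁₃CoPH_succ_of_tLaw₁₃CoPH_of_selLaws_coPH F N θ p h.toCore hθ hκ hE₀ hB₀ k hk hidem hdead hT

/-- **★ THE 𝐑-LEAF OF RECORD AT v1.7 `CoPH`, `ROpLeaf (VOfRecord₁₃CoPH θ p)`, FROM `Provisos₁₃SepCoPH`, ADMISSIBILITY, THE SIGNS AND THE SELECTOR LAWS OF THE RUN** (laws (i)(ii) at every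
level `k+1 ≤ K`) — N13's CoPH conjunct on every law-abiding selector; the live-selector face `…SepCoPH.rOpLeaf_VOfRecord₁₃CoPH_of_liveSel_sepCoPH` is the instance of §3.
[cite: Balaban1988Convergent, p.244, Thm 2 p.263; Balaban1989LargeFieldI, (0.3) p.176, p.177 (i)–(ii); Balaban1989LargeFieldII, Thm 1 p.355 (not exercised)] -/
theorem rOpLeaf_VOfRecord₁₃CoPH_of_selLaws_sepCoPH (h : θ.Provisos₁₃SepCoPH F N) (hθ : θ.Admissible F N) (hκ : 0 ≤ θ.s2.lf.κ) (hE₀ : 0 ≤ θ.s2.lf.E₀)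
    (hB₀ : 0 ≤ θ.s2.lf.B₀)
    (hidem : ∀ k, k < p.K → ∀ a, θ.ppSel p (gOfRecord₁₃ F N θ.toStage13Params p) (k + 1) (θ.ppSel p (gOfRecord₁₃ F N θ.toStage13Params p) (k + 1) a)
      = θ.ppSel p (gOfRecord₁₃ F N θ.toStage13Params p) (k + 1) a)
    (hdead : ∀ k, k < p.K → ∀ a, θ.ppSel p (gOfRecord₁₃ F N θ.toStage13Params p) (k + 1) a ≠ a →
      ∀ V, B15.BasicStep.fibreIntegral (fibOfSeq F θ.ν θ.τ9 p (gOfRecord₁₃ F N θ.toStage13Params p) (k + 1) a)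
        (rterm (sliceOfRecord F N θ.ν θ.τ9.M p (gOfRecord₁₃ F N θ.toStage13Params p) (k + 1)
          (slotsTOfRecord F N θ.ν θ.τ9 (EOfRecord₁₃ F N θ.toStage13Params) (wOfRecord₉ F N θ.toStage9Params) θ.ppSel p (gOfRecord₁₃ F N θ.toStage13Params p) (k + 1))) a) V = 0) :
    ROpLeaf (VOfRecord₁₃CoPH F N θ p) :=
  rOpLeaf_VOfRecord₁₃CoPH_of_selLaws_coPH F N θ p h.toCore hθ hκ hE₀ hB₀ hidem hdead

/-- **★ N13's (R₁₃CoPH) ROW `hR` OF THE STAGE-13 KNITS — `∀ k < K, TLaw₁₃CoPH θ p k → SLaw₁₃CoPH θ p (k+1)` — FROM `Provisos₁₃SepCoPH`, ADMISSIBILITY, THE SIGNS AND THE SELECTOR LAWS OF THE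
RUN**, no selector equation. [cite: Balaban1988Convergent, p.244 (bookkeeping); Balaban1989LargeFieldI, p.177 (i)–(ii); Balaban1989LargeFieldII, Thm 1 p.355 (not exercised)] -/
theorem laws₁₃CoPH_of_selLaws_sepCoPH (h : θ.Provisos₁₃SepCoPH F N) (hθ : θ.Admissible F N) (hκ : 0 ≤ θ.s2.lf.κ) (hE₀ : 0 ≤ θ.s2.lf.E₀) (hB₀ : 0 ≤ θ.s2.lf.B₀)
    (hidem : ∀ k, k < p.K → ∀ a, θ.ppSel p (gOfRecord₁₃ F N θ.toStage13Params p) (k + 1) (θ.ppSel p (gOfRecord₁₃ F N θ.toStage13Params p) (k + 1) a)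
      = θ.ppSel p (gOfRecord₁₃ F N θ.toStage13Params p) (k + 1) a)
    (hdead : ∀ k, k < p.K → ∀ a, θ.ppSel p (gOfRecord₁₃ F N θ.toStage13Params p) (k + 1) a ≠ a →
      ∀ V, B15.BasicStep.fibreIntegral (fibOfSeq F θ.ν θ.τ9 p (gOfRecord₁₃ F N θ.toStage13Params p) (k + 1) a)
        (rterm (sliceOfRecord F N θ.ν θ.τ9.M p (gOfRecord₁₃ F N θ.toStage13Params p) (k + 1)
          (slotsTOfRecord F N θ.ν θ.τ9 (EOfRecord₁₃ F N θ.toStage13Params) (wOfRecord₉ F N θ.toStage9Params) θ.ppSel p (gOfRecord₁₃ F N θ.toStage13Params p) (k + 1))) a) V = 0) :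
    ∀ k, k < p.K → TLaw₁₃CoPH F N θ p k → SLaw₁₃CoPH F N θ p (k + 1) :=
  laws₁₃CoPH_of_selLaws_coPH F N θ p h.toCore hθ hκ hE₀ hB₀ hidem hdead

/-- **The run's `rOperation` leaf reads TRUE at a world bound to the C-binding of record over the Stage-13 `CoPH` view, on every law-abiding selector, from `Provisos₁₃SepCoPH`.**
[cite: Balaban1988Convergent, p.244; Balaban1989LargeFieldI, p.177 (i)–(ii); Balaban1989LargeFieldII, Thm 1 p.355 (bookkeeping at the record)] -/
theorem rOperation_leavesP_of_selLaws₁₃CoPH_sepCoPH (w : WorldP) (hup : w.up p = upOfRecord₅C F N (θ.toStage5₁₃CoPH F N) p) (h : θ.Provisos₁₃SepCoPH F N)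
    (hθ : θ.Admissible F N) (hκ : 0 ≤ θ.s2.lf.κ) (hE₀ : 0 ≤ θ.s2.lf.E₀) (hB₀ : 0 ≤ θ.s2.lf.B₀)
    (hidem : ∀ k, k < p.K → ∀ a, θ.ppSel p (gOfRecord₁₃ F N θ.toStage13Params p) (k + 1) (θ.ppSel p (gOfRecord₁₃ F N θ.toStage13Params p) (k + 1) a)
      = θ.ppSel p (gOfRecord₁₃ F N θ.toStage13Params p) (k + 1) a)
    (hdead : ∀ k, k < p.K → ∀ a, θ.ppSel p (gOfRecord₁₃ F N θ.toStage13Params p) (k + 1) a ≠ a →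
      ∀ V, B15.BasicStep.fibreIntegral (fibOfSeq F θ.ν θ.τ9 p (gOfRecord₁₃ F N θ.toStage13Params p) (k + 1) a)
        (rterm (sliceOfRecord F N θ.ν θ.τ9.M p (gOfRecord₁₃ F N θ.toStage13Params p) (k + 1)
          (slotsTOfRecord F N θ.ν θ.τ9 (EOfRecord₁₃ F N θ.toStage13Params) (wOfRecord₉ F N θ.toStage9Params) θ.ppSel p (gOfRecord₁₃ F N θ.toStage13Params p) (k + 1))) a) V = 0) :
    (leavesP w p).rOperation := by
  show (w.up p).rOperation
  rw [hup, rOperation_upOfRecord₅C_stage13CoPH_iff]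
  exact laws₁₃CoPH_of_selLaws_sepCoPH F N θ p h hθ hκ hE₀ hB₀ hidem hdead

/-- **★ `ρ_{k+1} = 𝐓ρ_k` ALMOST EVERYWHERE from `Provisos₁₃SepCoPH`'s row `rstep` and the two selector laws at level `k+1`** (`k < K`): NO admissibility, NO sign, NO residual
∕ weight ∕ background is read — on a law-abiding selector 𝐑 of record changes no density of the run beyond a null set.
[cite: Balaban1989LargeFieldI, (0.2)–(0.4) p.176, p.177 (i)–(ii); Balaban1988Convergent, (2.18) p.257, (3.24)–(3.25) p.270; Balaban1989LargeFieldII, Thm 1 p.355 (not exercised)] -/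
theorem densOfRecord₁₃_succ_ae_eq_tdens_of_selLaws_sepCoPH (h : θ.Provisos₁₃SepCoPH F N) (k : ℕ) (hk : k < p.K)
    (hidem : ∀ a, θ.ppSel p (gOfRecord₁₃ F N θ.toStage13Params p) (k + 1) (θ.ppSel p (gOfRecord₁₃ F N θ.toStage13Params p) (k + 1) a)
      = θ.ppSel p (gOfRecord₁₃ F N θ.toStage13Params p) (k + 1) a)
    (hdead : ∀ a, θ.ppSel p (gOfRecord₁₃ F N θ.toStage13Params p) (k + 1) a ≠ a →
      ∀ V, B15.BasicStep.fibreIntegral (fibOfSeq F θ.ν θ.τ9 p (gOfRecord₁₃ F N θ.toStage13Params p) (k + 1) a)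
        (rterm (sliceOfRecord F N θ.ν θ.τ9.M p (gOfRecord₁₃ F N θ.toStage13Params p) (k + 1)
          (slotsTOfRecord F N θ.ν θ.τ9 (EOfRecord₁₃ F N θ.toStage13Params) (wOfRecord₉ F N θ.toStage9Params) θ.ppSel p (gOfRecord₁₃ F N θ.toStage13Params p) (k + 1))) a) V = 0) :
    densOfRecord₁₃ F N θ.toStage13Params p (k + 1) =ᵐ[fieldMeasure (F.P p.K) (k + 1) (SU N)] tdensOfRecord₁₃ F N θ.toStage13Params p k :=
  densOfRecord₁₃_succ_ae_eq_tdens_of_idem_of_dead_of_rstep F N θ.toStage13Params p (rstep_of_provisos₁₃SepCoPH h) k hk hidem hdead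

/-- **★ THE CONVERSE from `Provisos₁₃SepCoPH`'s row `rstep` and selector law (ii) ALONE**: `SLaw₁₃CoPH θ p (k+1)` ⇒ the a.e. two-branch 𝐓-form of `slotT_{k+1}` (residual `θ.rzAt p s`,
weights `WtOfRecord₁₃H θ p s`, background `UbgOfRecord₁₃CoP`) — a moved sequence is dead, a fixed point carries `slot = slotT` a.e. on the support; NO idempotency, NO admissibility, NO sign.
[cite: Balaban1988Convergent, (2.17)–(2.18) p.257, Thm 1 p.262, (3.24)–(3.25) p.270; Balaban1989LargeFieldI, (0.3) p.176, p.177 (ii)] -/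
theorem slotsT_succ_aeForm_of_sLaw₁₃CoPH_succ_of_deadSel_sepCoPH (h : θ.Provisos₁₃SepCoPH F N) (k : ℕ) (hk : k < p.K)
    (hdead : ∀ a, θ.ppSel p (gOfRecord₁₃ F N θ.toStage13Params p) (k + 1) a ≠ a →
      ∀ V, B15.BasicStep.fibreIntegral (fibOfSeq F θ.ν θ.τ9 p (gOfRecord₁₃ F N θ.toStage13Params p) (k + 1) a)
        (rterm (sliceOfRecord F N θ.ν θ.τ9.M p (gOfRecord₁₃ F N θ.toStage13Params p) (k + 1)
          (slotsTOfRecord F N θ.ν θ.τ9 (EOfRecord₁₃ F N θ.toStage13Params) (wOfRecord₉ F N θ.toStage9Params) θ.ppSel p (gOfRecord₁₃ F N θ.toStage13Params p) (k + 1))) a) V = 0)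
    (hS : SLaw₁₃CoPH F N θ p (k + 1)) :
    ∃ (t : SeqOfRecord F θ.ν θ.τ9.M (gOfRecord₁₃ F N θ.toStage13Params p) p.K (k + 1) → Sect2.TermValues (F.P p.K) (MatA N) (FluctV N) θ.τ9.M)
      (Ek : SeqOfRecord F θ.ν θ.τ9.M (gOfRecord₁₃ F N θ.toStage13Params p) p.K (k + 1) → ℝ), Sect2.UniversalE t ∧
      ∀ s, Sect2.LawsRT (sect2TowerOfRecord F N (FluctV N) p.K (settingOfRecord₁₃ F N θ.toStage13Params p) (θ.rzAt p s) s (t s)) (settingOfRecord₁₃ F N θ.toStage13Params p).lf (k + 1) ∧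
        ((∀ᵐ V ∂(fieldMeasure (F.P p.K) (k + 1) (SU N)), chiSeqOfRecord F N θ.ν θ.τ9.M (gOfRecord₁₃ F N θ.toStage13Params p) p.K (k + 1) s V ≠ 0 →
            slotsTOfRecord F N θ.ν θ.τ9 (EOfRecord₁₃ F N θ.toStage13Params) (wOfRecord₉ F N θ.toStage9Params) θ.ppSel p (gOfRecord₁₃ F N θ.toStage13Params p) (k + 1) s V = 0) ∨
          ∀ᵐ V ∂(fieldMeasure (F.P p.K) (k + 1) (SU N)), chiSeqOfRecord F N θ.ν θ.τ9.M (gOfRecord₁₃ F N θ.toStage13Params p) p.K (k + 1) s V ≠ 0 →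
            slotsTOfRecord F N θ.ν θ.τ9 (EOfRecord₁₃ F N θ.toStage13Params) (wOfRecord₉ F N θ.toStage9Params) θ.ppSel p (gOfRecord₁₃ F N θ.toStage13Params p) (k + 1) s V
              = sect2Slot F N (FluctV N) p.K (settingOfRecord₁₃ F N θ.toStage13Params p) (θ.rzAt p s) (WtOfRecord₁₃H F N θ p s) s (t s) (Ek s)
                  (UbgOfRecord₁₃CoP F N θ.toStage13Params p (k + 1) s) V) :=
  slotsT_succ_aeForm_of_AEZS_succ_of_dead_of_rstep F N θ.toStage13Params p (rstep_of_provisos₁₃SepCoPH h) k hk hdead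
    (θ.rzAt p) (WtOfRecord₁₃H F N θ p) (UbgOfRecord₁₃CoP F N θ.toStage13Params p (k + 1)) ((sLaw₁₃CoPH_iff F N θ p (k + 1)).mp hS)

/-- **The `SLaw₁₃CoPH`-side guard-free clause at a no-expansion sequence** (`Ω_{k+1}(s′) = ∅`, so `χ_{k+1}(s′) ≡ 1`) from row `rstep` and selector law (ii) alone.
[cite: Balaban1988Convergent, (3.25) p.270, remark p.262, Theorem p.245; Balaban1989LargeFieldI, (0.3) p.176, p.177 (ii)] -/
theorem sLaw₁₃CoPH_succ_clause_of_Omega_empty_of_deadSel_sepCoPH (h : θ.Provisos₁₃SepCoPH F N) {k : ℕ} (hk : k < p.K)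
    (hdead : ∀ a, θ.ppSel p (gOfRecord₁₃ F N θ.toStage13Params p) (k + 1) a ≠ a →
      ∀ V, B15.BasicStep.fibreIntegral (fibOfSeq F θ.ν θ.τ9 p (gOfRecord₁₃ F N θ.toStage13Params p) (k + 1) a)
        (rterm (sliceOfRecord F N θ.ν θ.τ9.M p (gOfRecord₁₃ F N θ.toStage13Params p) (k + 1)
          (slotsTOfRecord F N θ.ν θ.τ9 (EOfRecord₁₃ F N θ.toStage13Params) (wOfRecord₉ F N θ.toStage9Params) θ.ppSel p (gOfRecord₁₃ F N θ.toStage13Params p) (k + 1))) a) V = 0)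
    (hS : SLaw₁₃CoPH F N θ p (k + 1)) (s : SeqOfRecord F θ.ν θ.τ9.M (gOfRecord₁₃ F N θ.toStage13Params p) p.K (k + 1)) (hΩ : s.Ω (k + 1) = ∅) :
    ∃ (t : SeqOfRecord F θ.ν θ.τ9.M (gOfRecord₁₃ F N θ.toStage13Params p) p.K (k + 1) → Sect2.TermValues (F.P p.K) (MatA N) (FluctV N) θ.τ9.M)
      (Ek : SeqOfRecord F θ.ν θ.τ9.M (gOfRecord₁₃ F N θ.toStage13Params p) p.K (k + 1) → ℝ),
      Sect2.UniversalE t ∧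
      (∀ s', Sect2.LawsRT (sect2TowerOfRecord F N (FluctV N) p.K (settingOfRecord₁₃ F N θ.toStage13Params p) (θ.rzAt p s') s' (t s')) (settingOfRecord₁₃ F N θ.toStage13Params p).lf (k + 1)) ∧
      ((slotsTOfRecord F N θ.ν θ.τ9 (EOfRecord₁₃ F N θ.toStage13Params) (wOfRecord₉ F N θ.toStage9Params) θ.ppSel p (gOfRecord₁₃ F N θ.toStage13Params p) (k + 1) s
          =ᵐ[fieldMeasure (F.P p.K) (k + 1) (SU N)] 0) ∨
        ∀ᵐ V' ∂fieldMeasure (F.P p.K) (k + 1) (SU N),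
          slotsTOfRecord F N θ.ν θ.τ9 (EOfRecord₁₃ F N θ.toStage13Params) (wOfRecord₉ F N θ.toStage9Params) θ.ppSel p (gOfRecord₁₃ F N θ.toStage13Params p) (k + 1) s V' =
            sect2Slot F N (FluctV N) p.K (settingOfRecord₁₃ F N θ.toStage13Params p) (θ.rzAt p s) (WtOfRecord₁₃H F N θ p s) s (t s) (Ek s) (UbgOfRecord₁₃CoP F N θ.toStage13Params p (k + 1) s) V') :=
  aeClause_of_Omega_empty_of_AEZS_succ_of_dead_of_rstep F N θ.toStage13Params p (rstep_of_provisos₁₃SepCoPH h) hk hdead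
    (θ.rzAt p) (WtOfRecord₁₃H F N θ p) (UbgOfRecord₁₃CoP F N θ.toStage13Params p (k + 1)) ((sLaw₁₃CoPH_iff F N θ p (k + 1)).mp hS) s hΩ

/-- **★ ONE LEVEL WITH THE 𝐓-FORM DEMANDED AT THE `LiveSeq` SEQUENCES ONLY** (node00-def-K0a's currency for N11's share of Theorem 1): `SLaw₁₃CoPH θ p (k+1)` from row `rstep`, admissibility,
the signs, the two selector laws at level `k+1` and (S1ᵀ) at the live sequences (a sequence whose 𝐓-term has non-zero fibre mass somewhere IS `LiveSeq`:
`exists_live_of_fibreIntegral_rterm_ne_zero` + `liveSeq_of_ne_zero`; (G6″)'s `hasSect2FormAEZS_succ_of_liveTAEZS_of_idem_of_dead_of_rstep`).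
[cite: Balaban1988Convergent, §2 p.262, Thm 2 p.263, (3.24)–(3.25) p.270; Balaban1989LargeFieldI, (0.3) p.176, p.177 (i)–(ii)] -/
theorem sLaw₁₃CoPH_succ_of_tLawLiveSeq_of_selLaws_sepCoPH (h : θ.Provisos₁₃SepCoPH F N) (hθ : θ.Admissible F N) (hκ : 0 ≤ θ.s2.lf.κ) (hE₀ : 0 ≤ θ.s2.lf.E₀)
    (hB₀ : 0 ≤ θ.s2.lf.B₀) (k : ℕ) (hk : k < p.K)
    (hidem : ∀ a, θ.ppSel p (gOfRecord₁₃ F N θ.toStage13Params p) (k + 1) (θ.ppSel p (gOfRecord₁₃ F N θ.toStage13Params p) (k + 1) a)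
      = θ.ppSel p (gOfRecord₁₃ F N θ.toStage13Params p) (k + 1) a)
    (hdead : ∀ a, θ.ppSel p (gOfRecord₁₃ F N θ.toStage13Params p) (k + 1) a ≠ a →
      ∀ V, B15.BasicStep.fibreIntegral (fibOfSeq F θ.ν θ.τ9 p (gOfRecord₁₃ F N θ.toStage13Params p) (k + 1) a)
        (rterm (sliceOfRecord F N θ.ν θ.τ9.M p (gOfRecord₁₃ F N θ.toStage13Params p) (k + 1)
          (slotsTOfRecord F N θ.ν θ.τ9 (EOfRecord₁₃ F N θ.toStage13Params) (wOfRecord₉ F N θ.toStage9Params) θ.ppSel p (gOfRecord₁₃ F N θ.toStage13Params p) (k + 1))) a) V = 0)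
    (hT : ∃ (t : SeqOfRecord F θ.ν θ.τ9.M (gOfRecord₁₃ F N θ.toStage13Params p) p.K (k + 1) → Sect2.TermValues (F.P p.K) (MatA N) (FluctV N) θ.τ9.M)
      (Ek : SeqOfRecord F θ.ν θ.τ9.M (gOfRecord₁₃ F N θ.toStage13Params p) p.K (k + 1) → ℝ), Sect2.UniversalE t ∧
      ∀ s, Sect2.LawsT (sect2TowerOfRecord F N (FluctV N) p.K (settingOfRecord₁₃ F N θ.toStage13Params p) (θ.rzAt p s) s (t s)) (settingOfRecord₁₃ F N θ.toStage13Params p).lf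
          (settingOfRecord₁₃ F N θ.toStage13Params p).βc k ∧
        (LiveSeq F N θ.ν θ.τ9 p (gOfRecord₁₃ F N θ.toStage13Params p) (k + 1)
            (slotsTOfRecord F N θ.ν θ.τ9 (EOfRecord₁₃ F N θ.toStage13Params) (wOfRecord₉ F N θ.toStage9Params) θ.ppSel p (gOfRecord₁₃ F N θ.toStage13Params p) (k + 1)) s →
          (slotsTOfRecord F N θ.ν θ.τ9 (EOfRecord₁₃ F N θ.toStage13Params) (wOfRecord₉ F N θ.toStage9Params) θ.ppSel p (gOfRecord₁₃ F N θ.toStage13Params p) (k + 1) s = 0 ∨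
            ∀ᵐ V ∂(fieldMeasure (F.P p.K) (k + 1) (SU N)), chiSeqOfRecord F N θ.ν θ.τ9.M (gOfRecord₁₃ F N θ.toStage13Params p) p.K (k + 1) s V ≠ 0 →
              slotsTOfRecord F N θ.ν θ.τ9 (EOfRecord₁₃ F N θ.toStage13Params) (wOfRecord₉ F N θ.toStage9Params) θ.ppSel p (gOfRecord₁₃ F N θ.toStage13Params p) (k + 1) s V
                = sect2Slot F N (FluctV N) p.K (settingOfRecord₁₃ F N θ.toStage13Params p) (θ.rzAt p s) (WtOfRecord₁₃H F N θ p s) s (t s) (Ek s)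
                    (UbgOfRecord₁₃CoP F N θ.toStage13Params p (k + 1) s) V))) :
    SLaw₁₃CoPH F N θ p (k + 1) := by
  obtain ⟨t, Ek, hu, hs⟩ := hT
  refine (sLaw₁₃CoPH_iff F N θ p (k + 1)).mpr
    (hasSect2FormAEZS_succ_of_liveTAEZS_of_idem_of_dead_of_rstep F N θ.toStage13Params p (rstep_of_provisos₁₃SepCoPH h) hθ hκ hE₀ hB₀ k hk hidem hdead
      (θ.rzAt p) (WtOfRecord₁₃H F N θ p) (UbgOfRecord₁₃CoP F N θ.toStage13Params p (k + 1))
      ⟨t, Ek, hu, fun s => ⟨(hs s).1, fun ⟨V, hV⟩ => (hs s).2 ?_⟩⟩)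
  obtain ⟨V₁, hf, hI⟩ := exists_live_of_fibreIntegral_rterm_ne_zero
    (sliceOfRecord F N θ.ν θ.τ9.M p (gOfRecord₁₃ F N θ.toStage13Params p) (k + 1)
      (slotsTOfRecord F N θ.ν θ.τ9 (EOfRecord₁₃ F N θ.toStage13Params) (wOfRecord₉ F N θ.toStage9Params) θ.ppSel p (gOfRecord₁₃ F N θ.toStage13Params p) (k + 1)))
    (fibOfSeq F θ.ν θ.τ9 p (gOfRecord₁₃ F N θ.toStage13Params p) (k + 1)) s V hV
  exact liveSeq_of_ne_zero F N _ hf hI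

/-- **THEOREM 1 [III] ON EVERY LAW-ABIDING SELECTOR FROM THE FULL (S1ᵀ)** (`SLaw₁₃CoPH k → TLaw₁₃CoPH k`, N11's analysis DISPLAYED): `∀ k ≤ K, SLaw₁₃CoPH θ p k` (start `sLaw₁₃CoPH_zero`).
[cite: Balaban1988Convergent, Thm 1 p.262; Theorem p.245; p.244; Balaban1989LargeFieldI, p.177 (i)–(ii)] -/
theorem sLaw₁₃CoPH_all_of_thmP245_of_selLaws_sepCoPH (h : θ.Provisos₁₃SepCoPH F N) (hθ : θ.Admissible F N) (hκ : 0 ≤ θ.s2.lf.κ) (hE₀ : 0 ≤ θ.s2.lf.E₀)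
    (hB₀ : 0 ≤ θ.s2.lf.B₀)
    (hidem : ∀ k, k < p.K → ∀ a, θ.ppSel p (gOfRecord₁₃ F N θ.toStage13Params p) (k + 1) (θ.ppSel p (gOfRecord₁₃ F N θ.toStage13Params p) (k + 1) a)
      = θ.ppSel p (gOfRecord₁₃ F N θ.toStage13Params p) (k + 1) a)
    (hdead : ∀ k, k < p.K → ∀ a, θ.ppSel p (gOfRecord₁₃ F N θ.toStage13Params p) (k + 1) a ≠ a →
      ∀ V, B15.BasicStep.fibreIntegral (fibOfSeq F θ.ν θ.τ9 p (gOfRecord₁₃ F N θ.toStage13Params p) (k + 1) a)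
        (rterm (sliceOfRecord F N θ.ν θ.τ9.M p (gOfRecord₁₃ F N θ.toStage13Params p) (k + 1)
          (slotsTOfRecord F N θ.ν θ.τ9 (EOfRecord₁₃ F N θ.toStage13Params) (wOfRecord₉ F N θ.toStage9Params) θ.ppSel p (gOfRecord₁₃ F N θ.toStage13Params p) (k + 1))) a) V = 0)
    (hT : ∀ k, k < p.K → SLaw₁₃CoPH F N θ p k → TLaw₁₃CoPH F N θ p k) :
    ∀ k, k ≤ p.K → SLaw₁₃CoPH F N θ p k :=
  sLaw₁₃CoPH_all_of_laws F N θ p (laws₁₃CoPH_of_selLaws_sepCoPH F N θ p h hθ hκ hE₀ hB₀ hidem hdead) hT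

end SelLaws

/-! ## §2  THE DATUM-LEVEL JUNCTION at `datumOfRecord₁₃SepCoPH F N θ h` on a law-abiding selector -/

section Junction

variable (θ : Stage13HParams F N) (p : B12.RunParams) (w : WorldP) (h : θ.Provisos₁₃SepCoPH F N)

/-- **`densitiesDescribed` AT A v1.7 STAGE-13 WORLD ON A LAW-ABIDING SELECTOR FROM (S1ᵀ) ALONE** (the 𝐑-slot supplied by §1). [cite: Balaban1988Convergent, Thm 1 p.262; Theorem p.245; p.244; Balaban1989LargeFieldI, p.177 (i)–(ii)] -/
theorem densitiesDescribed_at_record₁₃SepCoPH_of_selLaws (hC : w.C = (datumOfRecord₁₃SepCoPH F N θ h).C) (hθ : θ.Admissible F N) (hκ : 0 ≤ θ.s2.lf.κ)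
    (hE₀ : 0 ≤ θ.s2.lf.E₀) (hB₀ : 0 ≤ θ.s2.lf.B₀)
    (hidem : ∀ k, k < p.K → ∀ a, θ.ppSel p (gOfRecord₁₃ F N θ.toStage13Params p) (k + 1) (θ.ppSel p (gOfRecord₁₃ F N θ.toStage13Params p) (k + 1) a)
      = θ.ppSel p (gOfRecord₁₃ F N θ.toStage13Params p) (k + 1) a)
    (hdead : ∀ k, k < p.K → ∀ a, θ.ppSel p (gOfRecord₁₃ F N θ.toStage13Params p) (k + 1) a ≠ a →
      ∀ V, B15.BasicStep.fibreIntegral (fibOfSeq F θ.ν θ.τ9 p (gOfRecord₁₃ F N θ.toStage13Params p) (k + 1) a)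
        (rterm (sliceOfRecord F N θ.ν θ.τ9.M p (gOfRecord₁₃ F N θ.toStage13Params p) (k + 1)
          (slotsTOfRecord F N θ.ν θ.τ9 (EOfRecord₁₃ F N θ.toStage13Params) (wOfRecord₉ F N θ.toStage9Params) θ.ppSel p (gOfRecord₁₃ F N θ.toStage13Params p) (k + 1))) a) V = 0)
    (hT : ∀ k, k < p.K → SLaw₁₃CoPH F N θ p k → TLaw₁₃CoPH F N θ p k) : (leavesP w p).densitiesDescribed :=
  densitiesDescribed_at_record₁₃SepCoPH_of_laws F N θ p w h hC (laws₁₃CoPH_of_selLaws_sepCoPH F N θ p h hθ hκ hE₀ hB₀ hidem hdead) hT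

/-- **N11 · `Dag.B14_main (leavesP w P)` AT A v1.7 STAGE-13 WORLD ON A LAW-ABIDING SELECTOR — ONE DISPLAYED SLOT (S1ᵀ), NO 𝐑-READING HYPOTHESIS** (the 𝐑-slot is §1's leaf).
[cite: Balaban1988Convergent, Thm 1 p.262; Theorem p.245; p.244; (2.6) p.255; Balaban1989LargeFieldI, p.177 (i)–(ii)] -/
theorem b14_main_at_record₁₃SepCoPH_of_selLaws (hC : w.C = (datumOfRecord₁₃SepCoPH F N θ h).C) (hθ : θ.Admissible F N) (hκ : 0 ≤ θ.s2.lf.κ)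
    (hE₀ : 0 ≤ θ.s2.lf.E₀) (hB₀ : 0 ≤ θ.s2.lf.B₀)
    (hidem : ∀ k, k < p.K → ∀ a, θ.ppSel p (gOfRecord₁₃ F N θ.toStage13Params p) (k + 1) (θ.ppSel p (gOfRecord₁₃ F N θ.toStage13Params p) (k + 1) a)
      = θ.ppSel p (gOfRecord₁₃ F N θ.toStage13Params p) (k + 1) a)
    (hdead : ∀ k, k < p.K → ∀ a, θ.ppSel p (gOfRecord₁₃ F N θ.toStage13Params p) (k + 1) a ≠ a →
      ∀ V, B15.BasicStep.fibreIntegral (fibOfSeq F θ.ν θ.τ9 p (gOfRecord₁₃ F N θ.toStage13Params p) (k + 1) a)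
        (rterm (sliceOfRecord F N θ.ν θ.τ9.M p (gOfRecord₁₃ F N θ.toStage13Params p) (k + 1)
          (slotsTOfRecord F N θ.ν θ.τ9 (EOfRecord₁₃ F N θ.toStage13Params) (wOfRecord₉ F N θ.toStage9Params) θ.ppSel p (gOfRecord₁₃ F N θ.toStage13Params p) (k + 1))) a) V = 0)
    (hT : (leavesP w p).b7 → (leavesP w p).b8 → (leavesP w p).b9 → (leavesP w p).b10 → (leavesP w p).b11 →
      (leavesP w p).smallCouplings → (leavesP w p).smallFieldInductive → (leavesP w p).flowControl →
        ∀ k, k < p.K → SLaw₁₃CoPH F N θ p k → TLaw₁₃CoPH F N θ p k) :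
    Dag.B14_main (leavesP w p) :=
  b14_main_at_record₁₃SepCoPH_of_rOpLeaf F N θ p w h hC (fun _ => rOpLeaf_VOfRecord₁₃CoPH_of_selLaws_sepCoPH F N θ p h hθ hκ hE₀ hB₀ hidem hdead) hT

/-- **★ THE (B)-FACE's FIRST CONJUNCT `B16.Thm1Printed (datumOfRecord₁₃SepCoPH F N θ h).C` ON A LAW-ABIDING SELECTOR FROM THE FULL (S1ᵀ) along the windowed runs** (node00-def-T's
`thm1Printed_datumOfRecord₁₃SepCoPH_of_tLaw_rOpLeaf` with the leaf SUPPLIED by §1 at every run; the selector laws of every run DISPLAYED).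
[cite: Balaban1989LargeFieldII, Thm 1 p.355; Balaban1988Convergent, Thm 1 p.262; Theorem p.245; p.244; Balaban1989LargeFieldI, p.177 (i)–(ii)] -/
theorem thm1Printed_datumOfRecord₁₃SepCoPH_of_laws_of_selLaws (hθ : θ.Admissible F N) (hκ : 0 ≤ θ.s2.lf.κ) (hE₀ : 0 ≤ θ.s2.lf.E₀) (hB₀ : 0 ≤ θ.s2.lf.B₀)
    {γ : ℝ} (hγ : 0 < γ)
    (hidem : ∀ (P : B12.RunParams) k, k < P.K → ∀ a, θ.ppSel P (gOfRecord₁₃ F N θ.toStage13Params P) (k + 1) (θ.ppSel P (gOfRecord₁₃ F N θ.toStage13Params P) (k + 1) a)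
      = θ.ppSel P (gOfRecord₁₃ F N θ.toStage13Params P) (k + 1) a)
    (hdead : ∀ (P : B12.RunParams) k, k < P.K → ∀ a, θ.ppSel P (gOfRecord₁₃ F N θ.toStage13Params P) (k + 1) a ≠ a →
      ∀ V, B15.BasicStep.fibreIntegral (fibOfSeq F θ.ν θ.τ9 P (gOfRecord₁₃ F N θ.toStage13Params P) (k + 1) a)
        (rterm (sliceOfRecord F N θ.ν θ.τ9.M P (gOfRecord₁₃ F N θ.toStage13Params P) (k + 1)
          (slotsTOfRecord F N θ.ν θ.τ9 (EOfRecord₁₃ F N θ.toStage13Params) (wOfRecord₉ F N θ.toStage9Params) θ.ppSel P (gOfRecord₁₃ F N θ.toStage13Params P) (k + 1))) a) V = 0)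
    (hT : ∀ P : B12.RunParams, ((datumOfRecord₁₃SepCoPH F N θ h).C P).flow.InInterval γ P.K →
      ∀ k, k < P.K → SLaw₁₃CoPH F N θ P k → TLaw₁₃CoPH F N θ P k) :
    B16.Thm1Printed (datumOfRecord₁₃SepCoPH F N θ h).C :=
  thm1Printed_datumOfRecord₁₃SepCoPH_of_tLaw_rOpLeaf F N θ h hγ hT
    (fun P _ => rOpLeaf_VOfRecord₁₃CoPH_of_selLaws_sepCoPH F N θ P h hθ hκ hE₀ hB₀ (hidem P) (hdead P))

/-- **★ THE (B)-FACE's FIRST CONJUNCT ON A LAW-ABIDING SELECTOR FROM (S1ᵀ) AT THE `LiveSeq` SEQUENCES ONLY** (`0 < γ`; base node00-def-T's `inductionBase_datumOfRecord₁₃SepCoPH`, step §1's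
`sLaw₁₃CoPH_succ_of_tLawLiveSeq_of_selLaws_sepCoPH` through `sect2Form_stage13SepCoPH_iff`; the selector laws of every windowed run DISPLAYED).
[cite: Balaban1989LargeFieldII, Thm 1 p.355 + p.391; Balaban1988Convergent, Thm 1 p.262; Theorem p.245; Balaban1989LargeFieldI, p.177 (i)–(ii)] -/
theorem thm1Printed_datumOfRecord₁₃SepCoPH_of_lawsLive_of_selLaws (hθ : θ.Admissible F N) (hκ : 0 ≤ θ.s2.lf.κ) (hE₀ : 0 ≤ θ.s2.lf.E₀)
    (hB₀ : 0 ≤ θ.s2.lf.B₀) {γ : ℝ} (hγ : 0 < γ)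
    (hidem : ∀ (P : B12.RunParams), ((datumOfRecord₁₃SepCoPH F N θ h).C P).flow.InInterval γ P.K → ∀ k, k < P.K → ∀ a,
      θ.ppSel P (gOfRecord₁₃ F N θ.toStage13Params P) (k + 1) (θ.ppSel P (gOfRecord₁₃ F N θ.toStage13Params P) (k + 1) a) = θ.ppSel P (gOfRecord₁₃ F N θ.toStage13Params P) (k + 1) a)
    (hdead : ∀ (P : B12.RunParams), ((datumOfRecord₁₃SepCoPH F N θ h).C P).flow.InInterval γ P.K → ∀ k, k < P.K → ∀ a,
      θ.ppSel P (gOfRecord₁₃ F N θ.toStage13Params P) (k + 1) a ≠ a →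
      ∀ V, B15.BasicStep.fibreIntegral (fibOfSeq F θ.ν θ.τ9 P (gOfRecord₁₃ F N θ.toStage13Params P) (k + 1) a)
        (rterm (sliceOfRecord F N θ.ν θ.τ9.M P (gOfRecord₁₃ F N θ.toStage13Params P) (k + 1)
          (slotsTOfRecord F N θ.ν θ.τ9 (EOfRecord₁₃ F N θ.toStage13Params) (wOfRecord₉ F N θ.toStage9Params) θ.ppSel P (gOfRecord₁₃ F N θ.toStage13Params P) (k + 1))) a) V = 0)
    (hT : ∀ P : B12.RunParams, ((datumOfRecord₁₃SepCoPH F N θ h).C P).flow.InInterval γ P.K → ∀ k, k < P.K → SLaw₁₃CoPH F N θ P k →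
      ∃ (t : SeqOfRecord F θ.ν θ.τ9.M (gOfRecord₁₃ F N θ.toStage13Params P) P.K (k + 1) → Sect2.TermValues (F.P P.K) (MatA N) (FluctV N) θ.τ9.M)
      (Ek : SeqOfRecord F θ.ν θ.τ9.M (gOfRecord₁₃ F N θ.toStage13Params P) P.K (k + 1) → ℝ), Sect2.UniversalE t ∧
      ∀ s, Sect2.LawsT (sect2TowerOfRecord F N (FluctV N) P.K (settingOfRecord₁₃ F N θ.toStage13Params P) (θ.rzAt P s) s (t s)) (settingOfRecord₁₃ F N θ.toStage13Params P).lf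
          (settingOfRecord₁₃ F N θ.toStage13Params P).βc k ∧
        (LiveSeq F N θ.ν θ.τ9 P (gOfRecord₁₃ F N θ.toStage13Params P) (k + 1)
            (slotsTOfRecord F N θ.ν θ.τ9 (EOfRecord₁₃ F N θ.toStage13Params) (wOfRecord₉ F N θ.toStage9Params) θ.ppSel P (gOfRecord₁₃ F N θ.toStage13Params P) (k + 1)) s →
          (slotsTOfRecord F N θ.ν θ.τ9 (EOfRecord₁₃ F N θ.toStage13Params) (wOfRecord₉ F N θ.toStage9Params) θ.ppSel P (gOfRecord₁₃ F N θ.toStage13Params P) (k + 1) s = 0 ∨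
            ∀ᵐ V ∂(fieldMeasure (F.P P.K) (k + 1) (SU N)), chiSeqOfRecord F N θ.ν θ.τ9.M (gOfRecord₁₃ F N θ.toStage13Params P) P.K (k + 1) s V ≠ 0 →
              slotsTOfRecord F N θ.ν θ.τ9 (EOfRecord₁₃ F N θ.toStage13Params) (wOfRecord₉ F N θ.toStage9Params) θ.ppSel P (gOfRecord₁₃ F N θ.toStage13Params P) (k + 1) s V
                = sect2Slot F N (FluctV N) P.K (settingOfRecord₁₃ F N θ.toStage13Params P) (θ.rzAt P s) (WtOfRecord₁₃H F N θ P s) s (t s) (Ek s)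
                    (UbgOfRecord₁₃CoP F N θ.toStage13Params P (k + 1) s) V))) :
    B16.Thm1Printed (datumOfRecord₁₃SepCoPH F N θ h).C := by
  refine B16.thm1_of_steps _ γ hγ (inductionBase_datumOfRecord₁₃SepCoPH F N θ h γ) fun P hP k hk hS => ?_
  have hS' : SLaw₁₃CoPH F N θ P k := (sLaw₁₃CoPH_iff F N θ P k).mpr ((sect2Form_stage13SepCoPH_iff F N θ h P k).mp hS)
  exact (sect2Form_stage13SepCoPH_iff F N θ h P (k + 1)).mpr ((sLaw₁₃CoPH_iff F N θ P (k + 1)).mp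
    (sLaw₁₃CoPH_succ_of_tLawLiveSeq_of_selLaws_sepCoPH F N θ P h hθ hκ hE₀ hB₀ k hk (hidem P hP k hk) (hdead P hP k hk) (hT P hP k hk hS')))

end Junction

/-! ## §3  INSTANCES of the selector laws (A6): the IDENTITY selector and node00-def-T's LIVE selector -/

section Instances

variable (θ : Stage13HParams F N) (p : B12.RunParams)

/-- **THE IDENTITY-SELECTOR BRANCH AT v1.7 `CoPH`**: a selector FIXING every sequence of every level `k+1 ≤ K` of the run obeys (i) trivially and (ii) vacuously, so the (R₁₃CoPH) row holds from
`Provisos₁₃SepCoPH`, admissibility and the signs — the Stage-13 twin of n13-c's `…B16RLeafRecord11.rOpLeaf_VOfRecord₁₁_of_forall_sel_eq` (identity `p–p′` selector `ppSelIdOfRecord`: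
𝐑 keeps every term). [cite: Balaban1988Convergent, p.244, Thm 2 p.263; Balaban1989LargeFieldI, (0.3) p.176, p.177 (i)–(ii); Balaban1989LargeFieldII, Thm 1 p.355 (not exercised)] -/
theorem laws₁₃CoPH_of_forall_sel_eq_sepCoPH (h : θ.Provisos₁₃SepCoPH F N) (hθ : θ.Admissible F N) (hκ : 0 ≤ θ.s2.lf.κ) (hE₀ : 0 ≤ θ.s2.lf.E₀) (hB₀ : 0 ≤ θ.s2.lf.B₀)
    (hid : ∀ k, k < p.K → ∀ a, θ.ppSel p (gOfRecord₁₃ F N θ.toStage13Params p) (k + 1) a = a) :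
    ∀ k, k < p.K → TLaw₁₃CoPH F N θ p k → SLaw₁₃CoPH F N θ p (k + 1) :=
  laws₁₃CoPH_of_selLaws_sepCoPH F N θ p h hθ hκ hE₀ hB₀ (fun k hk a => by rw [hid k hk a, hid k hk a]) (fun k hk a hne => absurd (hid k hk a) hne)

/-- **`ρ_{k+1} = 𝐓ρ_k` a.e. on the identity-selector branch** from row `rstep` alone (`k < K`). [cite: Balaban1989LargeFieldI, (0.2)–(0.4) p.176; Balaban1988Convergent, (2.18) p.257, (3.24)–(3.25) p.270] -/
theorem densOfRecord₁₃_succ_ae_eq_tdens_of_forall_sel_eq_sepCoPH (h : θ.Provisos₁₃SepCoPH F N) (k : ℕ) (hk : k < p.K)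
    (hid : ∀ a, θ.ppSel p (gOfRecord₁₃ F N θ.toStage13Params p) (k + 1) a = a) :
    densOfRecord₁₃ F N θ.toStage13Params p (k + 1) =ᵐ[fieldMeasure (F.P p.K) (k + 1) (SU N)] tdensOfRecord₁₃ F N θ.toStage13Params p k :=
  densOfRecord₁₃_succ_ae_eq_tdens_of_selLaws_sepCoPH F N θ p h k hk (fun a => by rw [hid a, hid a]) (fun a hne => absurd (hid a) hne)

end Instances

end Literature.MathematicalPhysics.QuantumFieldTheory.Balaban1983to89.B16RLeafRecord13SepCoPHSelLaws
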